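import Literature.MathematicalPhysics.QuantumFieldTheory.Balaban1983to89.Beta.Assembly

/-!
# `Balaban1983to89.Beta.PrefixAbsorption` — the FINITE-PREFIX ABSORPTION asked by the cell's referee row G-beta-18:
«∀ k» versus «for k sufficiently large» in the flow input, which constants of [I] (0.31) and [III] (2.6)–(2.9)/(2.46)
absorb finitely many merely-bounded β's, and how the standing hypothesis `0 < g_k ≤ γ` survives the prefix
(cell `pub-balaban`, unit `b2b-balaban-strat-b14` = β sub-cell CO-LEAD, [III] side; node T11.F; answer row GAPS C-sb14-13)

HONEST FRAMING (cell rule, verbatim, page 1 of everything): discharging `BetaPertH` makes Bałaban's UV stability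
UNCONDITIONAL — a real constructive-QFT result; it is NOT the continuum limit and NOT the Clay problem.  (Gloss,
BETA-SPEC v1.8d/v1.9b l. 17–18, GAPS G-ref2-14 (a) / G-ref2-20 (a) / G-ref2-23 (a), verbatim: «UNCONDITIONAL» in
[Balaban1989LargeFieldII] (B16) p. 355's interval-hypothesis sense ONLY (`FlowStepRuns.p355Unconditional_of_partialSums`
keeps `hnodes`); the located leaves G-adv3-2 (left inequality of (0.1)/(2.50), d = 4), G-adv3-1 (U2 transfer of B14
Cor. 3's lower bound) and `SecondExpLeaf` REMAIN.  Gloss 2, BETA-SPEC v1.9e, referee row C-beta-78, BINDING: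
«UNCONDITIONAL» = `Beta.Assembly.EventualForm`-unconditional — the END statement with the interval hypothesis removed,
(0.31) in DEFECTED form on all lattices (`thm2Defected_of_eventualForm` below), admissible couplings shrunk to
`g ≤ g⋆`; NOT «[Balaban1987RG1] Theorem 2 as printed» (that needs the small-k signs (AF-0s) or the large-L form
(AF-0-L) for every k in addition: `eventualForm_not_thm2Printed` below); never the continuum limit / mass gap / Clay.)
(v1.0.1, 2026-08-18: module docstring only — the two glosses inserted per G-ref2-23 (a); no declaration touched.)
THIS MODULE DISCHARGES NOTHING: every theorem is bookkeeping over real sequences and over the cell's hypothesis carriers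
(`FlowStep.HBeta`, `Beta.Assembly.EventualForm`, `B12.Construction`); nothing about Bałaban's β-functions (1.22) is
asserted.  ABSOLUTE RULE (cell rule, verbatim): "No internally-minted statement may enter as a cited fact. Every
hypothesis is either kernel-proved in this package or a verbatim quotation of a PUBLISHED theorem with page reference.
The manuscript(s) under audit are NOT citable for their own disputed steps — they are the thing under adjudication;
programme-internal (2001/route/tribunal) claims are never citable."

CITATION HEADER (lean-in-tree rule).  T. Bałaban, *Renormalization group approach to lattice gauge field theories. I*,
Commun. Math. Phys. **109**, 249–301 (1987) [Balaban1987RG1] = [I] (cell paper B12; journal page = PDF page + 248;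
renders `HOME/b2b-balaban-ref1/pages/1987-cmp109-rg-I-small-field/…-p011-x2.png`, `…-p012-x2.png` READ as images for
this module), p. 259 [11], Theorem 1: *"If the sequence of the effective coupling constants is contained in an interval
]0, γ] with a sufficiently small positive γ, then the effective actions for small fields are given by the formulas
(0.22)–(0.24), with terms satisfying (0.29)."* followed by *"It is interesting to notice that we do not assume any
special asymptotic behavior of the coupling constants, like asymptotic freedom."*; Theorem 2 with (0.31)
*"1/g² + β log(L^k ε)^{−1} ≤ 1/g_k² ≤ 1/g² + β′ log(L^k ε)^{−1}"* and *"there exist constants β, β′, 0 < β ≤ β′"*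
(typed by the cell as `B12.Thm2Printed`; STATED WITHOUT PROOF in print — under adjudication, never a `theorem`).
T. Bałaban, *Convergent renormalization expansions for lattice gauge theories*, Commun. Math. Phys. **119**, 243–285
(1988) [Balaban1988Convergent] = [III] (cell paper B14; render `…1988-cmp119-convergent-renormalization-p013-x2.png`
READ), p. 255 [13], after (2.6): *"where n > m, and β₀ > 0 can be chosen arbitrarily small, if g is sufficiently small.
The inequalities follow from the renormalization group equations (0.20) [I], and from the properties of the
β-functions."*  WHAT IS REPRODUCED: nothing of either paper is re-proved here; the module records, at statement level,
what an EVENTUAL positive lower bound on the β-functions (the shape «for k ≥ k₀», cell BETA-SPEC §5.5 (EV-AF)) gives and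
does NOT give of the printed (0.31), with every constant explicit.  (Cell context, NOT a citation: the referee row
G-beta-18 was prompted by a snippet-level reading of the 1985 Erice lectures of Bałaban–Jaffe — cell rows S-lit3g4-2 /
D-lit3g4.1, no page image seen by any seat — according to which the two-sided sandwich on the β-functions is asserted
there only for n sufficiently large; nothing of that text is quoted or used below.)

WHAT IS PROVED HERE (all `[folklore]` real-sequence bookkeeping unless a display is named):
1. §1 (run level, `Setup.Flow`) `defected031_of_eventualLower`: along (0.20) up to `K` with the realised β-values
   `≥ −β′` at every scale, `≤ β′` at every scale and `≥ b ≥ 0` at the scales `j ≥ k₀`, for EVERY `k ≤ K`: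
   `1/g_K² + b(K−k) − (b+β′)k₀ ≤ 1/g_k²`, `1/g_K² − β′k₀ ≤ 1/g_k²`, `1/g_k² ≤ 1/g_K² + β′(K−k)` — the two-sided (0.31) on
   ALL lattices with the printed upper constant, the lower SLOPE `b` and an ADDITIVE DEFECT `(b+β′)k₀`;
   `inInterval_of_endpointSmall`: hence `0 < g_k ≤ γ` for all `k ≤ K` as soon as the couplings are positive and the
   renormalised coupling satisfies `1/γ² + β′k₀ ≤ 1/g_K²` — the MECHANISM by which the standing hypothesis of [I] Thm 1 /
   [III] Thm 1 survives the prefix (γ itself, the smallness threshold of the RG steps, is untouched; only the admissible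
   renormalised couplings shrink, K-uniformly).  At run level the β-bounds are hypotheses on realised values; the
   history-level existence statement, where the printed bound is available only INSIDE the box, is item 2.
2. §2 (history level, `EventualForm`) `thm2Defected_of_eventualForm`: for a forward-generated construction and a
   carrier `E : EventualForm β` ((EV-AF) `β_{k+1} ≥ b > 0` on ]0,γ₀]^{k+1} for `k ≥ k₀` — OPEN for (1.22); (TS) printed;
   (C)), for every torus exponent `m`, every `γ ∈ ]0,γ₀]`, every `g > 0` with `1/γ² + β′k₀ ≤ 1/g²` and EVERY `K`: a bare
   coupling whose run stays in ]0,γ], ends at `g_K = g` and satisfies the defected two-sided running of item 1 (via the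
   clamped forward shooting `FlowStepRuns.couplingTrajectory_exists_partialSums`).  With `EventualForm.thm2_fineLattices`
   (row an5: literal (0.31) with `b/2` on the lattices `K ≥ k₀(3+2β′/b)`), `EventualForm.endpointExistence`,
   `EventualForm.p355_and_sum246` and `Beta.FlowConsumers.eventualForm_flowControl_along` this is the complete list of
   what the eventual form gives: EVERY located consumer of the flow, and (0.31) in the two weakened forms.
3. §3 the «∀ k» form is the `k₀ = 0` INSTANCE: `exists_eventualForm_of_pointwise` (`0 < b ≤ β_{k+1} ≤ β′` on all boxes
   + (C) ⇒ an `EventualForm` with `k₀ = 0`), `exists_eventualForm_of_betaAFH`, `exists_eventualForm_of_betaPertH`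
   (the cell's literal `FlowStep.BetaPertH β β̄`, `β̄ > 0`, + (C)), and `thm2Printed_of_eventualForm_k₀_zero`: with
   `k₀ = 0` the literal `B12.Thm2Printed` follows (empty small-k list in `EventualForm.thm2Printed_of_list`).
4. §4 the literal (0.31) at EVERY lattice spacing is NOT a consequence of the eventual form — kernel NEGATIVE:
   `beta_zero_ge_of_discrete031_one` (on the lattice `K = 1` the lower half of the discrete (0.31) with constant `c` IS
   `c ≤ β_1(g_0)`), `first_beta_pos_of_thm2Printed` (a forward-generated construction satisfying `B12.Thm2Printed C L`,
   `L > 1`, realises bare couplings at which `β_1 > 0`), and `eventualForm_not_thm2Printed`: the admissible family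
   `β_1 ≡ −1`, `β_{k+1} ≡ 1 (k ≥ 1)` carries an `EventualForm` (`k₀ = 1`) while its canonical construction
   (`FlowStepRuns.modelOf`) violates `B12.Thm2Printed · L` for every `L > 1`.  So [I] Theorem 2 AS PRINTED («0 < β», all
   `K ≥ 1`) needs, beyond (EV-AF)+(TS)+(C), sign information at the scales `k < k₀` — sufficient: the finite list
   `β_{k+1} ≥ b` on the boxes for `k < k₀` (`EventualForm.thm2Printed_of_list`); necessary: at least `β_1 > 0` at the
   realised bare couplings (`first_beta_pos_of_thm2Printed`) — and that information is consumed by NO located consumer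
   of the cell's end statement ([Balaban1989LargeFieldII] p. 355 needs endpoint existence only:
   `FlowStepRuns.uvUnconditional_of_endpoint`).
CENSUS CONSEQUENCE (answer to G-beta-18, cell GAPS C-sb14-13): the discharge target of the END-STATEMENT grade is the
eventual form `EventualForm β` (any `k₀`; the «∀ k» forms `BetaAFH`/`BetaPertH` are its `k₀ = 0` instances and are what
the large-`L` road (AF-0-L) of `Beta.LargeL` would deliver); the finite prefix costs (i) the additive defect
`(b+β′)k₀` in (0.31) — or `b ↦ b/2` on fine lattices —, (ii) the shrinking `γ ↦ (1/γ² + β′k₀)^{−1/2}` of the admissible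
renormalised couplings, (iii) the γ-smallness `(b+β′)k₀γ² ≤ β₀(2+β₀)`, `≤ 1/2` in (2.6)–(2.9)/(2.46) whose printed
constants are otherwise UNCHANGED (`B14FlowStep.flowControl_of_eventualLower`); the literal ∀-K (0.31) is the one
statement that additionally needs small-k sign information.  `k₀`, `b`, `β′`, `γ₀` are data of the carrier —
independent of `g`, `K`, `ε`, so nothing is circular.  Imports `Beta.Assembly` (→ `FlowStepRuns`, `B14FlowStep`, `FlowStep`,
`DagBinding`); restates nothing of them; Mathlib only otherwise; no `sorry`/`axiom`.  Value = kernel bookkeeping + one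
kernel negative for the census, NOT summit progress.
-/

namespace Literature.MathematicalPhysics.QuantumFieldTheory.Balaban1983to89.Beta.PrefixAbsorption

open Literature.MathematicalPhysics.QuantumFieldTheory.Balaban1983to89
open Literature.MathematicalPhysics.QuantumFieldTheory.Balaban1983to89.FlowStep
open Literature.MathematicalPhysics.QuantumFieldTheory.Balaban1983to89.DagBinding
open Literature.MathematicalPhysics.QuantumFieldTheory.Balaban1983to89.FlowStepRuns
open Literature.MathematicalPhysics.QuantumFieldTheory.Balaban1983to89.Beta.Assembly

noncomputable section

/-! ## 1. Run level: the DEFECTED two-sided (0.31) on ALL lattices from an eventual lower bound + the printed two-sided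
bound; the interval hypothesis survives the prefix -/

/-- Partial sums of realised β-values that are `≤ β′` at every scale are `≤ β′(n−m)`. [folklore] -/
theorem sum_le_of_upper (F : Flow) (K : ℕ) {β' : ℝ} (hub : ∀ j, j < K → F.β (j + 1) (F.g j) ≤ β')
    {m n : ℕ} (hmn : m ≤ n) (hnK : n ≤ K) :
    ∑ j ∈ Finset.Ico m n, F.β (j + 1) (F.g j) ≤ β' * ((n : ℝ) - m) := by
  have h1 : ∑ j ∈ Finset.Ico m n, F.β (j + 1) (F.g j) ≤ ∑ _j ∈ Finset.Ico m n, β' :=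
    Finset.sum_le_sum fun j hj => hub j (lt_of_lt_of_le (Finset.mem_Ico.mp hj).2 hnK)
  have h2 : ∑ _j ∈ Finset.Ico m n, β' = β' * ((n : ℝ) - m) := by
    rw [Finset.sum_const, Nat.card_Ico, nsmul_eq_mul, Nat.cast_sub hmn]; ring
  linarith

/-- **The DEFECTED (0.31) on ALL lattices, run level.**  Along a flow solving (0.20) up to `K` whose realised β-values
satisfy the PRINTED two-sided bound `−β′ ≤ β_{j+1}(g_j) ≤ β′` for all `j < K` ([Balaban1987RG1] p. 264 "uniformly
bounded", read along the run) and the EVENTUAL lower bound `b ≤ β_{j+1}(g_j)` for `k₀ ≤ j < K` (`b ≥ 0`), for every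
`k ≤ K`: (a) `1/g_K² + b(K−k) − (b+β′)k₀ ≤ 1/g_k²` — the lower half of the discrete (0.31) with slope `b` and the ADDITIVE
DEFECT `(b+β′)k₀`; (b) `1/g_K² − β′k₀ ≤ 1/g_k²` — the prefix costs at most `β′k₀`; (c) `1/g_k² ≤ 1/g_K² + β′(K−k)` — the
printed upper half, unchanged.  No largeness of `K`, no sign at the scales `j < k₀`.
[cite: Balaban1987RG1, (0.31) p.259 and (0.20) p.256] -/
theorem defected031_of_eventualLower (F : Flow) (K : ℕ) {b β' : ℝ} {k₀ : ℕ} (hb : 0 ≤ b) (hβ' : 0 ≤ β')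
    (hrg : F.SatisfiesRG K) (hlo : ∀ j, j < K → -β' ≤ F.β (j + 1) (F.g j))
    (hub : ∀ j, j < K → F.β (j + 1) (F.g j) ≤ β')
    (htail : ∀ j, k₀ ≤ j → j < K → b ≤ F.β (j + 1) (F.g j)) :
    ∀ k, k ≤ K →
      1 / (F.g K) ^ 2 + b * ((K : ℝ) - k) - (b + β') * k₀ ≤ 1 / (F.g k) ^ 2 ∧
      1 / (F.g K) ^ 2 - β' * k₀ ≤ 1 / (F.g k) ^ 2 ∧
      1 / (F.g k) ^ 2 ≤ 1 / (F.g K) ^ 2 + β' * ((K : ℝ) - k) := by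
  intro k hk
  have tel := Step.inv_sq_telescope ((Step.rgEq_iff F K).mp hrg) hk le_rfl
  have hav := B14FlowStep.avgAF_of_eventualLower F K hβ' hb hlo htail k K hk le_rfl
  have hav0 := B14FlowStep.avgAF_of_eventualLower F K hβ' le_rfl hlo
    (fun j hj hjK => hb.trans (htail j hj hjK)) k K hk le_rfl
  have hup := sum_le_of_upper F K hub hk le_rfl
  refine ⟨by linarith, ?_, by linarith⟩
  have : (0 : ℝ) * ((K : ℝ) - k) - (0 + β') * k₀ = -(β' * k₀) := by ring
  rw [this] at hav0
  linarith

/-- **How `0 < g_k ≤ γ` survives the prefix (run level).**  Along (0.20) up to `K` with positive couplings, realised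
β-values `≥ −β′` at every scale and `≥ 0` at the scales `j ≥ k₀`, and a renormalised coupling with
`1/γ² + β′k₀ ≤ 1/g_K²`: every `g_k`, `k ≤ K`, lies in ]0,γ] — the standing hypothesis of [Balaban1987RG1] Thm 1 (p. 259:
*"contained in an interval ]0, γ] with a sufficiently small positive γ"*).  `γ` is NOT changed; only the admissible
renormalised couplings shrink to `g ≤ (1/γ² + β′k₀)^{−1/2}`, uniformly in `K`.  (At the history level, where the printed
bound holds only INSIDE the box, the run is PRODUCED with this property by clamped forward shooting:
`thm2Defected_of_eventualForm`.) [cite: Balaban1987RG1, Thm 1 p.259 and (0.20) p.256] -/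
theorem inInterval_of_endpointSmall (F : Flow) (K : ℕ) {γ β' : ℝ} {k₀ : ℕ} (hγ : 0 < γ) (hβ' : 0 ≤ β')
    (hrg : F.SatisfiesRG K) (hpos : ∀ k, k ≤ K → 0 < F.g k)
    (hlo : ∀ j, j < K → -β' ≤ F.β (j + 1) (F.g j))
    (htail : ∀ j, k₀ ≤ j → j < K → 0 ≤ F.β (j + 1) (F.g j))
    (hend : 1 / γ ^ 2 + β' * k₀ ≤ 1 / (F.g K) ^ 2) : F.InInterval γ K := by
  intro k hk
  -- only the lower bounds are used: instantiate the averaged bound with `b = 0`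
  have tel := Step.inv_sq_telescope ((Step.rgEq_iff F K).mp hrg) hk le_rfl
  have hav0 := B14FlowStep.avgAF_of_eventualLower F K hβ' le_rfl hlo htail k K hk le_rfl
  have e : (0 : ℝ) * ((K : ℝ) - k) - (0 + β') * k₀ = -(β' * k₀) := by ring
  rw [e] at hav0
  have hlow : 1 / γ ^ 2 ≤ 1 / (F.g k) ^ 2 := by linarith
  have hgk := hpos k hk
  refine ⟨hgk, ?_⟩
  have h2 : (F.g k) ^ 2 ≤ γ ^ 2 := by
    rwa [one_div_le_one_div (by positivity) (by positivity)] at hlow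
  nlinarith [hgk, hγ]

/-! ## 2. History level: the eventual form gives, on EVERY lattice, a run in ]0,γ] ending at the prescribed coupling
with the defected two-sided running -/

/-- History-typed defected lower half: along ONE solution of the history recursion (0.20) whose prefixes lie in the box
]0,γ₀], (EV-AF) from `k₀` on + the printed lower half `−β′` give `1/g_K² + b(K−k) − (b+β′)k₀ ≤ 1/g_k²` for every
`k ≤ K` — the all-lattice companion of `FlowStepRuns.discrete031H_lower_of_eventualLower_largeK` (which trades the defect
for `b ↦ b/2` when `(3b + 2β′)k₀ ≤ bK`). [cite: Balaban1987RG1, (0.31) p.259 and (0.20) p.256] -/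
theorem defected031H_of_eventualLower {β : HBeta} {K : ℕ} {gs : ℕ → ℝ} {γ₀ b β' : ℝ} {k₀ : ℕ}
    (hb : 0 ≤ b) (hβ' : 0 ≤ β') (hrg : RGEqH K β gs) (hbox : ∀ j, j < K → prefixOf gs j ∈ Box γ₀ j)
    (htail : ∀ k, k₀ ≤ k → ∀ v ∈ Box γ₀ k, b ≤ β k v) (hlo : ∀ k, ∀ v ∈ Box γ₀ k, -β' ≤ β k v) :
    ∀ k, k ≤ K → 1 / (gs K) ^ 2 + b * ((K : ℝ) - k) - (b + β') * k₀ ≤ 1 / (gs k) ^ 2 := by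
  intro k hk
  have tel := inv_sq_telescopeH hrg hk le_rfl
  have hpt : ∀ j ∈ Finset.Ico k K,
      b - (if j < k₀ then (b + β') else 0) ≤ β j (prefixOf gs j) := by
    intro j hj
    have hjK : j < K := (Finset.mem_Ico.mp hj).2
    by_cases hjk : j < k₀
    · rw [if_pos hjk]; have := hlo j _ (hbox j hjK); linarith
    · rw [if_neg hjk]; have := htail j (not_lt.mp hjk) _ (hbox j hjK); linarith
  have hsum := Finset.sum_le_sum hpt
  have hs1 : ∑ _j ∈ Finset.Ico k K, (b : ℝ) = b * ((K : ℝ) - k) := by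
    rw [Finset.sum_const, Nat.card_Ico, nsmul_eq_mul, Nat.cast_sub hk]; ring
  have hs2 : ∑ j ∈ Finset.Ico k K, (if j < k₀ then (b + β') else 0)
      = (((Finset.Ico k K).filter (· < k₀)).card : ℝ) * (b + β') := by
    rw [Finset.sum_ite, Finset.sum_const_zero, add_zero, Finset.sum_const, nsmul_eq_mul]
  rw [Finset.sum_sub_distrib, hs1, hs2] at hsum
  have hcard : (((Finset.Ico k K).filter (· < k₀)).card : ℝ) ≤ k₀ := by
    exact_mod_cast B14FlowStep.card_filter_lt_Ico_le k K k₀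
  have hbb : 0 ≤ b + β' := by linarith
  have h1 : (((Finset.Ico k K).filter (· < k₀)).card : ℝ) * (b + β') ≤ (k₀ : ℝ) * (b + β') :=
    mul_le_mul_of_nonneg_right hcard hbb
  linarith

/-- **[Balaban1987RG1] Theorem 2's conclusion in DEFECTED form on EVERY lattice, from the eventual form alone**
(forward-generated constructions).  For a carrier `E : EventualForm β` — (EV-AF) `β_{k+1} ≥ b > 0` on ]0,γ₀]^{k+1} for
`k ≥ k₀` (OPEN for (1.22)), (TS) the PRINTED two-sided bound `−β′ ≤ β_{k+1} ≤ β′` on the boxes, (C) joint continuity —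
for every torus exponent `m`, every `γ ∈ ]0,γ₀]`, every renormalised `g > 0` with `1/γ² + β′k₀ ≤ 1/g²` and EVERY number
of steps `K`, some bare coupling produces a run with `0 < g_k ≤ γ` for all `k ≤ K`, `g_K = g`, and
`1/g² + b(K−k) − (b+β′)k₀ ≤ 1/g_k²`, `1/g² − β′k₀ ≤ 1/g_k²`, `1/g_k² ≤ 1/g² + β′(K−k)` for all `k ≤ K`.  The interval
hypothesis is a CONCLUSION (clamped forward shooting `FlowStepRuns.couplingTrajectory_exists_partialSums` with
`M = β′k₀`); `γ` is untouched; nothing depends on `K`.  Compare `EventualForm.thm2_fineLattices` (slope `b/2`, no defect,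
on the lattices `(3b+2β′)k₀ ≤ bK`) and `EventualForm.thm2Printed_of_list` (the literal (0.31), which needs the small-k
signs).  A REDUCTION to the located unprinted input (EV-AF); nothing of the series is asserted.
[cite: Balaban1987RG1, Thm 2 (0.31) p.259] -/
theorem thm2Defected_of_eventualForm {β : HBeta} (E : EventualForm β) {C : B12.Construction}
    (hgen : ForwardGenerated C β) :
    ∀ (m : ℕ) (γ : ℝ), 0 < γ → γ ≤ E.γ₀ → ∀ g : ℝ, 0 < g → 1 / γ ^ 2 + E.β' * E.k₀ ≤ 1 / g ^ 2 →
      ∀ K : ℕ, ∃ g0 : ℝ, (C ⟨K, m, g0⟩).flow.InInterval γ K ∧ (C ⟨K, m, g0⟩).flow.g K = g ∧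
        ∀ k, k ≤ K →
          1 / g ^ 2 + E.b * ((K : ℝ) - k) - (E.b + E.β') * E.k₀ ≤ 1 / ((C ⟨K, m, g0⟩).flow.g k) ^ 2 ∧
          1 / g ^ 2 - E.β' * E.k₀ ≤ 1 / ((C ⟨K, m, g0⟩).flow.g k) ^ 2 ∧
          1 / ((C ⟨K, m, g0⟩).flow.g k) ^ 2 ≤ 1 / g ^ 2 + E.β' * ((K : ℝ) - k) := by
  intro m γ hγ hγle g hg hgM K
  have hps : BetaPartialSumsLowerH (E.β' * E.k₀) E.γ₀ β := E.partialSums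
  have hcont' : BetaContH γ β := fun k => (E.cont k).mono (box_mono hγle k)
  have hup' : BetaUpperH E.β' γ β := fun k v hv => E.upper k v (box_mono hγle k hv)
  have hM : 0 ≤ E.β' * E.k₀ := mul_nonneg E.β'_pos.le (Nat.cast_nonneg _)
  obtain ⟨gs, hgsK, hrg, hI, hbounds⟩ := couplingTrajectory_exists_partialSums β hγ hM E.β'_pos.le hcont'
    (betaPartialSumsLowerH_mono hγle hps) hup' K g hg hgM
  have heq : ∀ k, k ≤ K → (C ⟨K, m, gs 0⟩).flow.g k = gs k :=
    flow_eq_of_rgEqH (C ⟨K, m, gs 0⟩).flow β K (fun k hk => hgen.2 ⟨K, m, gs 0⟩ k hk)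
      (hgen.1 ⟨K, m, gs 0⟩) hrg (fun k hk => (hI k hk).1)
  have hbox : ∀ j, j < K → prefixOf gs j ∈ Box E.γ₀ j := fun j hj =>
    mem_box.mpr fun i => by
      have hi : (i : ℕ) ≤ K := by have := i.isLt; omega
      exact ⟨(hI i hi).1, (hI i hi).2.trans hγle⟩
  have hlow := defected031H_of_eventualLower E.b_pos.le E.β'_pos.le hrg hbox E.tail E.lower
  refine ⟨gs 0, fun k hk => ?_, ?_, fun k hk => ?_⟩
  · rw [heq k hk]; exact hI k hk
  · rw [heq K le_rfl]; exact hgsK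
  · rw [heq k hk]
    refine ⟨?_, (hbounds k hk).1, (hbounds k hk).2⟩
    have h := hlow k hk
    rw [hgsK] at h
    exact h

/-- The admissible renormalised couplings of the eventual form: `g⋆(γ) = (1/γ² + β′k₀)^{−1/2}` is positive, `≤ γ`, and
`1/γ² + β′k₀ ≤ 1/g²` for every `g ∈ ]0, g⋆(γ)]` — so "for a sufficiently small positive g" (p. 259) is met with a
threshold independent of `K`. [cite: Balaban1987RG1, Thm 2 p.259 (first sentence)] -/
theorem gstar_spec (E_β' : ℝ) (k₀ : ℕ) (hβ' : 0 ≤ E_β') {γ : ℝ} (hγ : 0 < γ) :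
    0 < 1 / Real.sqrt (1 / γ ^ 2 + E_β' * k₀) ∧ 1 / Real.sqrt (1 / γ ^ 2 + E_β' * k₀) ≤ γ ∧
      ∀ g : ℝ, 0 < g → g ≤ 1 / Real.sqrt (1 / γ ^ 2 + E_β' * k₀) →
        1 / γ ^ 2 + E_β' * k₀ ≤ 1 / g ^ 2 := by
  set A : ℝ := 1 / γ ^ 2 + E_β' * k₀ with hA
  have hM : 0 ≤ E_β' * k₀ := mul_nonneg hβ' (Nat.cast_nonneg _)
  have hApos : 0 < A := by positivity
  have hgs : 1 / (1 / Real.sqrt A) ^ 2 = A := by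
    rw [div_pow, one_pow, Real.sq_sqrt hApos.le, one_div_one_div]
  have hgs_pos : 0 < 1 / Real.sqrt A := by positivity
  refine ⟨hgs_pos, ?_, fun g hg hgle => ?_⟩
  · have h1 : 1 / γ ^ 2 ≤ 1 / (1 / Real.sqrt A) ^ 2 := by rw [hgs]; linarith
    have h2 : (1 / Real.sqrt A) ^ 2 ≤ γ ^ 2 := by
      rwa [one_div_le_one_div (by positivity) (by positivity)] at h1
    nlinarith [hgs_pos, hγ]
  · rw [← hgs]
    exact one_div_le_one_div_of_le (by positivity) (pow_le_pow_left₀ hg.le hgle 2)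

/-! ## 3. The «∀ k» forms are the `k₀ = 0` instances of the eventual form (and give the LITERAL Theorem 2) -/

/-- **`EventualForm` with `k₀ = 0` from POINTWISE bounds on all boxes**: `0 < b ≤ β_{k+1} ≤ β′` on ]0,γ₀]^{k+1} for every
`k` (the «∀ k» shape of the cell's `FlowStep.BetaAFH` with an explicit box and upper constant) plus joint continuity.
[cite: Balaban1987RG1, §1 p.264] -/
theorem exists_eventualForm_of_pointwise {β : HBeta} {γ₀ b β' : ℝ} (hγ₀ : 0 < γ₀) (hb : 0 < b)
    (hlo : BetaLowerH b γ₀ β) (hup : BetaUpperH β' γ₀ β) (hcont : BetaContH γ₀ β) :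
    ∃ E : EventualForm β, E.k₀ = 0 ∧ E.γ₀ = γ₀ ∧ E.b = b ∧ E.β' = β' := by
  refine ⟨⟨γ₀, hγ₀, b, hb, 0, fun k _ v hv => hlo k v hv, β', hup, fun k v hv => ?_, hcont⟩,
    rfl, rfl, rfl, rfl⟩
  have h1 : b ≤ β k v := hlo k v hv
  have h2 : β k v ≤ β' := hup k v hv
  linarith

/-- **`EventualForm` with `k₀ = 0` from the cell's `FlowStep.BetaAFH`** (∃ γ₀, b > 0 with `β_{k+1} ≥ b` on all boxes),
given the printed upper bound and joint continuity on some box ]0,γ₁]: restrict to `min γ₀ γ₁`. [cite: Balaban1987RG1, §1 p.264] -/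
theorem exists_eventualForm_of_betaAFH {β : HBeta} (h : BetaAFH β) {γ₁ β' : ℝ} (hγ₁ : 0 < γ₁)
    (hup : BetaUpperH β' γ₁ β) (hcont : BetaContH γ₁ β) : ∃ E : EventualForm β, E.k₀ = 0 := by
  obtain ⟨γ₀, hγ₀, b, hb, hlo⟩ := h
  have hle0 : min γ₀ γ₁ ≤ γ₀ := min_le_left _ _
  have hle1 : min γ₀ γ₁ ≤ γ₁ := min_le_right _ _
  obtain ⟨E, hE, -⟩ := exists_eventualForm_of_pointwise (lt_min hγ₀ hγ₁) hb
    (fun k v hv => hlo k v (box_mono hle0 k hv)) (fun k v hv => hup k v (box_mono hle1 k hv))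
    (fun k => (hcont k).mono (box_mono hle1 k))
  exact ⟨E, hE⟩

/-- **`EventualForm` with `k₀ = 0` from the cell's LITERAL `FlowStep.BetaPertH β β̄` with `β̄ > 0`** (one k-independent
constant with an O(γ²) remainder; rigid and presumably false for (1.22) — `BetaPertRigid`, DIVERGENCE D-b12-3 — recorded
so that the coordinator's name `betaPertH_holds` has a kernel edge into the honest target), given joint continuity on
some box: `FlowStep.betaAFH_of_pert` + `betaUpperH_of_pert`. [cite: Balaban1989LargeFieldII, p.355] -/
theorem exists_eventualForm_of_betaPertH {β : HBeta} {βbar : ℝ} (hbar : 0 < βbar) (h : BetaPertH β βbar)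
    {γ₁ : ℝ} (hγ₁ : 0 < γ₁) (hcont : BetaContH γ₁ β) : ∃ E : EventualForm β, E.k₀ = 0 := by
  obtain ⟨γ₂, hγ₂, β', hup⟩ := betaUpperH_of_pert h
  have hle1 : min γ₁ γ₂ ≤ γ₁ := min_le_left _ _
  have hle2 : min γ₁ γ₂ ≤ γ₂ := min_le_right _ _
  exact exists_eventualForm_of_betaAFH (betaAFH_of_pert hbar h) (lt_min hγ₁ hγ₂)
    (fun k v hv => hup k v (box_mono hle2 k hv)) (fun k => (hcont k).mono (box_mono hle1 k))

/-- **With `k₀ = 0` the LITERAL Theorem 2 follows** (`B12.Thm2Printed C L`, (0.31) with `β = b/log L`, `β′/log L`):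
the small-k list of `EventualForm.thm2Printed_of_list` is empty. [cite: Balaban1987RG1, Thm 2 (0.31) p.259] -/
theorem thm2Printed_of_eventualForm_k₀_zero {β : HBeta} (E : EventualForm β) (hk : E.k₀ = 0)
    {C : B12.Construction} (hgen : ForwardGenerated C β) {L : ℝ} (hL : 1 < L) : B12.Thm2Printed C L :=
  E.thm2Printed_of_list hgen hL fun k hk' => absurd hk' (by rw [hk]; exact Nat.not_lt_zero k)

/-! ## 4. Kernel NEGATIVE: the literal (0.31) at every lattice spacing is NOT a consequence of the eventual form — on the
coarsest lattice its lower half IS the sign of the first β-function -/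

/-- On the lattice `K = 1` the lower half of the discrete (0.31) with constant `c` at `k = 0` reads `c ≤ β_1(g_0)`:
along the one-step history recursion `1/g_0² = 1/g_1² + β_1(g_0)` with `g_1 = g`. [cite: Balaban1987RG1, (0.31) p.259 and (0.20) p.256] -/
theorem beta_zero_ge_of_discrete031_one {β : HBeta} {gs : ℕ → ℝ} {c β' g : ℝ} (hrg : RGEqH 1 β gs)
    (hK : gs 1 = g) (hD : Step.Discrete031 c β' 1 g gs) : c ≤ β 0 (prefixOf gs 0) := by
  have h0 := hrg 0 Nat.zero_lt_one
  have h1 := (hD 0 (Nat.zero_le 1)).1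
  simp only [Nat.cast_one, Nat.cast_zero, sub_zero, mul_one] at h1
  rw [hK] at h0
  linarith

/-- Conversely the sign at `k = 0` gives that lower half on `K = 1` (so on the coarsest lattice the two are the same
statement). [cite: Balaban1987RG1, (0.31) p.259 and (0.20) p.256] -/
theorem discrete031_one_lower_iff {β : HBeta} {gs : ℕ → ℝ} {c g : ℝ} (hrg : RGEqH 1 β gs) (hK : gs 1 = g) :
    (∀ k : ℕ, k ≤ 1 → 1 / g ^ 2 + c * ((1 : ℝ) - (k : ℝ)) ≤ 1 / (gs k) ^ 2) ↔ c ≤ β 0 (prefixOf gs 0) := by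
  have h0 := hrg 0 Nat.zero_lt_one
  rw [hK] at h0
  constructor
  · intro h
    have h1 := h 0 (Nat.zero_le 1)
    simp only [Nat.cast_zero, sub_zero, mul_one] at h1
    linarith
  · intro hc k hk
    interval_cases k
    · simp only [Nat.cast_zero, sub_zero, mul_one]
      linarith
    · simp only [Nat.cast_one, sub_self, mul_zero, add_zero, hK]
      exact le_rfl

/-- **NECESSITY of the first sign for the LITERAL Theorem 2.**  If a construction generated forward by (0.20) with the
curried family `β` (halting outside) satisfies `B12.Thm2Printed C L` with `L > 1`, then for every torus exponent `m` it
realises bare couplings `g_0 > 0` at which `β_1(g_0) ≥ β log L > 0` (`β` the printed lower constant): the run with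
`K = 1`. [cite: Balaban1987RG1, Thm 2 (0.31) p.259] -/
theorem first_beta_pos_of_thm2Printed {C : B12.Construction} {β : HBeta} (hgen : ForwardGenerated C β)
    (hhalt : HaltsOutside C β) (hcur : CurriesHBeta C β) {L : ℝ} (hL : 1 < L) (h : B12.Thm2Printed C L)
    (m : ℕ) : ∃ g0 : ℝ, 0 < g0 ∧ 0 < β 0 (prefixOf (C ⟨1, m, g0⟩).flow.g 0) := by
  obtain ⟨γ₂, hγ₂, hγ⟩ := h m
  obtain ⟨gstar, hgstar, hg⟩ := hγ γ₂ hγ₂ le_rfl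
  obtain ⟨b, β', hb, -, hK⟩ := hg gstar hgstar le_rfl
  obtain ⟨g0, hI, hend, hbounds⟩ := hK 1
  have hrg : RGEqH 1 β (C ⟨1, m, g0⟩).flow.g := rgEqH_of_inInterval hgen hhalt hcur ⟨1, m, g0⟩ hI
  have h0 := hrg 0 Nat.zero_lt_one
  have h1 := (hbounds 0 (Nat.zero_le 1)).1
  simp only [Nat.cast_one, Nat.cast_zero, sub_zero, one_mul] at h1
  rw [hend] at h0
  have hlog : 0 < Real.log L := Real.log_pos hL
  have hpos : 0 < b * Real.log L := mul_pos hb hlog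
  have hg0 : (C ⟨1, m, g0⟩).flow.g 0 = g0 := hgen.1 ⟨1, m, g0⟩
  refine ⟨g0, ?_, by linarith⟩
  rw [← hg0]; exact (hI 0 (Nat.zero_le 1)).1

/-- **The eventual form does NOT give [Balaban1987RG1] Theorem 2 AS PRINTED** (kernel witness for the census).  The
history-independent family `β_1 ≡ −1`, `β_{k+1} ≡ 1` for `k ≥ 1` carries an `EventualForm` (`γ₀ = 1`, `b = 1`, `k₀ = 1`,
`β′ = 1`), yet its canonical forward-generated construction `FlowStepRuns.modelOf` violates `B12.Thm2Printed · L` for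
every block size `L > 1`: on the lattice `K = 1` the lower half of (0.31) would force `β_1 > 0`
(`first_beta_pos_of_thm2Printed`).  Hence some small-k sign information (sufficient: the finite list of
`EventualForm.thm2Printed_of_list`) cannot be dropped for the LITERAL (0.31) on coarse lattices — while
`thm2Defected_of_eventualForm` (all lattices, additive defect) and `EventualForm.thm2_fineLattices` (slope `b/2`,
`K ≥ k₀(3+2β′/b)`) hold for this family as for every eventual form.  A statement about the cell's carriers, not about
(1.22). [folklore] -/
theorem eventualForm_not_thm2Printed :
    ∃ β : HBeta, Nonempty (EventualForm β) ∧ ∀ L : ℝ, 1 < L → ¬ B12.Thm2Printed (modelOf β) L := by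
  let βf : HBeta := fun k _ => if k = 0 then (-1 : ℝ) else 1
  have hval0 : ∀ v, βf 0 v = -1 := fun v => by simp [βf]
  have hval1 : ∀ k v, k ≠ 0 → βf k v = 1 := fun k v hk => by simp [βf, hk]
  refine ⟨βf, ⟨⟨1, one_pos, 1, one_pos, 1, fun k hk v _ => ?_, 1, fun k v _ => ?_, fun k v _ => ?_,
    fun _ => continuousOn_const⟩⟩, fun L hL hT => ?_⟩
  · rw [hval1 k v (by omega)]
  · by_cases hk : k = 0
    · subst hk; rw [hval0 v]; norm_num
    · rw [hval1 k v hk]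
  · by_cases hk : k = 0
    · subst hk; rw [hval0 v]
    · rw [hval1 k v hk]; norm_num
  · obtain ⟨g0, -, hpos⟩ := first_beta_pos_of_thm2Printed (modelOf_forwardGenerated βf) (modelOf_haltsOutside βf)
      (modelOf_curries βf) hL hT 0
    have := hval0 (prefixOf (modelOf βf ⟨1, 0, g0⟩).flow.g 0)
    linarith

/-- The same witness read positively: for that family the eventual form's own conclusions are available — e.g. endpoint
existence for its canonical construction (`EventualForm.endpointExistence`), although the literal Theorem 2 fails.
[folklore] -/
theorem witness_endpointExistence :
    ∃ β : HBeta, Nonempty (EventualForm β) ∧ EndpointExistence (modelOf β) ∧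
      ∀ L : ℝ, 1 < L → ¬ B12.Thm2Printed (modelOf β) L := by
  obtain ⟨β, ⟨E⟩, hnot⟩ := eventualForm_not_thm2Printed
  exact ⟨β, ⟨E⟩, E.endpointExistence (modelOf_forwardGenerated β), hnot⟩

end

end Literature.MathematicalPhysics.QuantumFieldTheory.Balaban1983to89.Beta.PrefixAbsorption
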